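import Summits.QuantumAdvantage.QuantumAdvantage.Theses.CubicForrelation
import Summits.QuantumAdvantage.QuantumAdvantage.Theorems.CubicForrelationNearExactIsExactMmNormalForm
import Literature.Computability.QuantumComplexity.ForrelationDirectSum
import Literature.Computability.AlgebraicComplexity.PowerSumNonvanishing

/-!
# Crux `CubicForrelation.NearExactIsExact` (stmt-QuantumAdvantage-14043) — stub `stub_ammNormalForm`

Line `direct-sum-amplification`, stub AN (KNOWN branch, the `(a, a+2)`-split twin of stub N
`stub_mmNormalForm`): the ALMOST-Maiorana–McFarland NORMAL FORM of a cubic `g` on `(a+1) + (a+1)` bits carrying an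
`a`-dimensional subspace `V` (`0 ∈ V`, xor-closed, `4|V|² = 2^{(a+1)+(a+1)}`, all second differences of `g` along
`V` vanish), Dillon/McFarland straightening [J. F. Dillon, PhD thesis, Univ. of Maryland (1974); C. Carlet,
*Boolean Functions for Cryptography and Coding Theory* (CUP 2021), Prop. 54].

Statement.  There are `f₁ g₁` on `a + (a+2)` bits, `φ : 𝔽₂^{a+2} → 𝔽₂^a` coordinatewise QUADRATIC and `h` CUBIC with
`f₁` cubic, `(-1)^{g₁(y₁ ‖ y₂)} = (-1)^{⟨y₁, φ y₂⟩} (-1)^{h y₂}`, `Φ(f₁, g₁) = Φ(f, g)`, and every M-subspace of `g₁`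
(`0 ∈ V₁`, xor-closed, `|V₁|² = 2^{a+(a+2)}`, second differences of `g₁` vanish along `V₁`) gives one of `g`.

Proof.  Read Bool-vectors in `ZMod 2` along `ind` (the dictionary `dnf_*`).  `V` is an `a`-dimensional subspace `S`
(`dnf_exists_submodule`, `dnf_finrank_eq`), straightened by a linear BIJECTION
`Ψ : 𝔽₂^{a+(a+2)} → 𝔽₂^{(a+1)+(a+1)}`, `Ψ(p ‖ q) = w(q) + Σ_i p_i v_i`, `v_i` a basis of `S`, `w` a linear
isomorphism onto a complement of `S` (dimension `a + 2`; `an_exists_linearEquiv`); vanishing second differences make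
`g` affine along `S` (`dnf_affine`).  With the (rectangular, invertible) matrix `M` of `Ψ` put `g₁ := g ∘ M` and
`f₁ := f ∘ (M⁻¹)ᵀ`: `⟨x, M y⟩ = ⟨Mᵀ x, y⟩` and two reindexings of the double sum (now over two equinumerous types)
give `Φ(f₁, g₁) = Φ(f, g)`; a linear substitution does not raise the algebraic degree (`nf_isDegLeFun_mulVec`).
In the new coordinates `φ y₂ i = g₁(0 ‖ y₂) ⊕ g₁(e_i ‖ y₂)` is a restricted derivative of the cubic `g₁`, hence
quadratic by the hypothesis `hD` (stub D of the line), and `h = g₁(0 ‖ ·)` is a restriction of the cubic `g₁`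
(`nf_isDegLeFun_restrict`).  Finally the bijection `e : y ↦ ind⁻¹(M · ind y)` is additive (`bxor ↦ bxor`) with
`g ∘ e = g₁`, so it carries an M-subspace `V₁` of `g₁` to the M-subspace `e(V₁)` of `g`.
-/

set_option linter.dupNamespace false -- D-0017: single-problem summit ⇒ `QuantumAdvantage.QuantumAdvantage` by design

namespace Summit.QuantumAdvantage.QuantumAdvantage.Theorems.CubicForrelation.NearExactIsExact

open Finset
open scoped Matrix
open Literature.Computability.QuantumComplexity
open Literature.Computability.QuantumComplexity.BuzetChailloux (bxor zeroVec signOf_sq)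
open Summit.QuantumAdvantage.QuantumAdvantage.Theorems.ExactPairsMaioranaMcFarland.Negative
  (ind ind_injective ind_bx ite_xor)
open Summit.QuantumAdvantage.QuantumAdvantage.Theorems.CubicForrelation.ExactPairsMaioranaMcFarland
  (dnf_ind_surjective dnf_ind_append dnf_chi_add dnf_signOf_eq_chi dnf_twist_eq_chi dnf_exists_submodule
    dnf_finrank_eq dnf_hD_transport dnf_affine)

/-! ### The straightening bijection for an `a`-dimensional subspace of `𝔽₂^{(a+1)+(a+1)}` -/

/-- `4|V|² = 2^{(a+1)+(a+1)}` forces `|V| = 2^a`. -/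
theorem an_card_eq {a c : ℕ} (h : c * c * 4 = 2 ^ ((a + 1) + (a + 1))) : c = 2 ^ a := by
  have h4 : c * c * 4 = 2 ^ a * 2 ^ a * 4 := by rw [h]; ring
  exact Nat.mul_self_inj.1 (Nat.eq_of_mul_eq_mul_right (by norm_num) h4)

/-- For an `a`-dimensional subspace `S ≤ 𝔽₂^{(a+1)+(a+1)}` there is a linear bijection
`Ψ : 𝔽₂^{a+(a+2)} ≃ 𝔽₂^{(a+1)+(a+1)}` sending the block vector `p ‖ q` to `w(q) + Σ_i p_i • v_i` with
`v_0, …, v_{a-1}` (a basis of) `S`: concatenate a basis of `S` with a basis of a complement (dimension `a + 2`). -/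
theorem an_exists_linearEquiv (a : ℕ) (S : Submodule (ZMod 2) (Fin ((a + 1) + (a + 1)) → ZMod 2))
    (hS : Module.finrank (ZMod 2) S = a) :
    ∃ Ψ : (Fin (a + (a + 2)) → ZMod 2) ≃ₗ[ZMod 2] (Fin ((a + 1) + (a + 1)) → ZMod 2),
      ∃ v : Fin a → (Fin ((a + 1) + (a + 1)) → ZMod 2),
        ∃ w : (Fin (a + 2) → ZMod 2) → (Fin ((a + 1) + (a + 1)) → ZMod 2),
          (∀ i, v i ∈ S) ∧ ∀ (p : Fin a → ZMod 2) (q : Fin (a + 2) → ZMod 2),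
            Ψ (Fin.append p q) = w q + ∑ i, p i • v i := by
  obtain ⟨S', hc⟩ := S.exists_isCompl
  have hS' : Module.finrank (ZMod 2) S' = a + 2 := by
    have h1 := Submodule.finrank_add_eq_of_isCompl hc
    rw [hS, Module.finrank_fintype_fun_eq_card, Fintype.card_fin] at h1
    omega
  let bV := Module.finBasisOfFinrankEq (ZMod 2) S hS
  let bW := Module.finBasisOfFinrankEq (ZMod 2) S' hS'
  let E1 : (Fin (a + (a + 2)) → ZMod 2) ≃ₗ[ZMod 2] ((Fin a → ZMod 2) × (Fin (a + 2) → ZMod 2)) :=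
    (Fin.appendEquiv a (a + 2)).symm.toLinearEquiv ⟨fun _ _ => rfl, fun _ _ => rfl⟩
  have hE1 : ∀ (p : Fin a → ZMod 2) (q : Fin (a + 2) → ZMod 2), E1 (Fin.append p q) = (p, q) := fun p q =>
    (Fin.appendEquiv a (a + 2)).symm_apply_apply (p, q)
  refine ⟨E1.trans ((bV.equivFun.symm.prodCongr bW.equivFun.symm).trans
      (Submodule.prodEquivOfIsCompl S S' hc)),
    fun i => (bV i : Fin ((a + 1) + (a + 1)) → ZMod 2),
    fun q => ((bW.equivFun.symm q : S') : Fin ((a + 1) + (a + 1)) → ZMod 2),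
    fun i => (bV i).2, fun p q => ?_⟩
  rw [LinearEquiv.trans_apply, LinearEquiv.trans_apply, hE1, LinearEquiv.prodCongr_apply,
    Submodule.coe_prodEquivOfIsCompl']
  simp only [Module.Basis.equivFun_symm_apply, Submodule.coe_sum, Submodule.coe_smul]
  exact add_comm _ _

/-! ### The almost-Maiorana–McFarland normal form -/

/-- **Almost-Maiorana–McFarland normal form of an `a`-dimensional M-subspace** (Dillon 1974; Carlet 2021,
Prop. 54), stub AN of the line `direct-sum-amplification`.  If the cubic `g` on `(a+1) + (a+1)` bits is affine on
every coset of an `a`-dimensional subspace `V` (`0 ∈ V`, xor-closed, `4|V|² = 2^{(a+1)+(a+1)}`, all second differences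
of `g` along `V` vanish), then after a LINEAR bijective change of coordinates on the `g`-side (`g₁ = g ∘ M`,
`M : 𝔽₂^{a+(a+2)} → 𝔽₂^{(a+1)+(a+1)}` straightening `V` onto the `y₁`-block `𝔽₂^a`) and the transpose-inverse change
on the `f`-side (`f₁ = f ∘ (M⁻¹)ᵀ`, preserving `⟨x, y⟩`, hence the forrelation, and all degrees), the sign of `g₁`
has the shape `(-1)^{g₁(y₁ ‖ y₂)} = (-1)^{⟨y₁, φ y₂⟩} (-1)^{h y₂}` with `φ` coordinatewise quadratic (a restricted
derivative of the cubic `g₁`, by the hypothesis = stub D) and `h = g₁(0 ‖ ·)` cubic; moreover every M-subspace of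
`g₁` is carried by the (additive) coordinate change to an M-subspace of `g`. -/
theorem stub_ammNormalForm :
    (∀ (n d : ℕ) (e : (Fin n → Bool) → Bool) (t : Fin n → Bool), IsDegLeFun (d + 1) e →
      IsDegLeFun d (fun x => e x ^^ e (bxor x t))) →
    ∀ (a : ℕ) (f g : (Fin ((a + 1) + (a + 1)) → Bool) → Bool), IsDegLeFun 3 f → IsDegLeFun 3 g →
      (∃ V : Finset (Fin ((a + 1) + (a + 1)) → Bool), zeroVec ∈ V ∧ (∀ x ∈ V, ∀ y ∈ V, bxor x y ∈ V) ∧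
        V.card * V.card * 4 = 2 ^ ((a + 1) + (a + 1)) ∧
        ∀ u ∈ V, ∀ v ∈ V, ∀ y, (g y ^^ g (bxor y u) ^^ g (bxor y v) ^^ g (bxor y (bxor u v))) = false) →
      ∃ (f₁ g₁ : (Fin (a + (a + 2)) → Bool) → Bool) (φ : (Fin (a + 2) → Bool) → (Fin a → Bool))
        (h : (Fin (a + 2) → Bool) → Bool),
        IsDegLeFun 3 f₁ ∧ (∀ i : Fin a, IsDegLeFun 2 (fun y => φ y i)) ∧ IsDegLeFun 3 h ∧
        (∀ (y₁ : Fin a → Bool) (y₂ : Fin (a + 2) → Bool),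
          signOf (g₁ (Fin.append y₁ y₂)) = twist y₁ (φ y₂) * signOf (h y₂)) ∧
        forrelation f₁ g₁ = forrelation f g ∧
        ((∃ V : Finset (Fin (a + (a + 2)) → Bool), zeroVec ∈ V ∧ (∀ x ∈ V, ∀ y ∈ V, bxor x y ∈ V) ∧
            V.card * V.card = 2 ^ (a + (a + 2)) ∧
            ∀ u ∈ V, ∀ v ∈ V, ∀ y, (g₁ y ^^ g₁ (bxor y u) ^^ g₁ (bxor y v) ^^ g₁ (bxor y (bxor u v))) = false) →
          ∃ V : Finset (Fin ((a + 1) + (a + 1)) → Bool), zeroVec ∈ V ∧ (∀ x ∈ V, ∀ y ∈ V, bxor x y ∈ V) ∧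
            V.card * V.card = 2 ^ ((a + 1) + (a + 1)) ∧
            ∀ u ∈ V, ∀ v ∈ V, ∀ y, (g y ^^ g (bxor y u) ^^ g (bxor y v) ^^ g (bxor y (bxor u v))) = false) := by
  intro hD a f g hf hg hV
  obtain ⟨V, hV0, hVx, hVc, hD4⟩ := hV
  have hKN : a + (a + 2) = (a + 1) + (a + 1) := by omega
  have hVc' : V.card = 2 ^ a := an_card_eq hVc
  have hD3 : ∀ p ∈ V, ∀ q ∈ V, ∀ x : Fin ((a + 1) + (a + 1)) → Bool,
      (g x ^^ g (bxor x p) ^^ g (bxor x q) ^^ g (bxor (bxor x p) q)) = false := by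
    intro p hp q hq x
    have key := hD4 p hp q hq x
    rwa [show bxor x (bxor p q) = bxor (bxor x p) q from
      funext fun i => (Bool.xor_assoc (x i) (p i) (q i)).symm] at key
  have hbx : ∀ {n : ℕ} (x y : Fin n → Bool), ind (bxor x y) = ind x + ind y := fun x y => ind_bx x y
  -- the Bool / `ZMod 2` dictionaries on `(a+1)+(a+1)` and on `a+(a+2)` bits, and the pulled-back function `G`
  obtain ⟨ιn, hι⟩ : ∃ ι : (Fin ((a + 1) + (a + 1)) → Bool) ≃ (Fin ((a + 1) + (a + 1)) → ZMod 2),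
      ∀ x, ι x = ind x :=
    ⟨Equiv.ofBijective ind ⟨ind_injective, dnf_ind_surjective⟩, fun _ => rfl⟩
  have hι' : ∀ v, ind (ιn.symm v) = v := fun v => by rw [← hι, Equiv.apply_symm_apply]
  have hιs : ∀ x, ιn.symm (ind x) = x := fun x => by rw [← hι, Equiv.symm_apply_apply]
  obtain ⟨ιk, hιk⟩ : ∃ ι : (Fin (a + (a + 2)) → Bool) ≃ (Fin (a + (a + 2)) → ZMod 2), ∀ x, ι x = ind x :=
    ⟨Equiv.ofBijective ind ⟨ind_injective, dnf_ind_surjective⟩, fun _ => rfl⟩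
  have hιk' : ∀ v, ind (ιk.symm v) = v := fun v => by rw [← hιk, Equiv.apply_symm_apply]
  have hιks : ∀ x, ιk.symm (ind x) = x := fun x => by rw [← hιk, Equiv.symm_apply_apply]
  obtain ⟨G, hG, hGι⟩ : ∃ G : (Fin ((a + 1) + (a + 1)) → ZMod 2) → Bool,
      (∀ x, G (ind x) = g x) ∧ ∀ v, g (ιn.symm v) = G v :=
    ⟨fun v => g (ιn.symm v), fun x => by
      show g (ιn.symm (ind x)) = g x
      rw [hιs], fun _ => rfl⟩
  -- the subspace `S` (= `V` read in `ZMod 2`), of dimension `a`, and the straightening bijection `Ψ`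
  obtain ⟨S, hSV, hScard⟩ := dnf_exists_submodule V hVx ⟨zeroVec, hV0⟩
  have hSa : Module.finrank (ZMod 2) S = a := dnf_finrank_eq S (by rw [hScard, hVc'])
  obtain ⟨Ψ, bV, w, hbV, hΨ⟩ := an_exists_linearEquiv a S hSa
  have hD' := dnf_hD_transport g G hG V S hSV hD3
  -- the (rectangular) matrices of `Ψ` and `Ψ⁻¹`
  obtain ⟨M, hΨM, hMdef⟩ : ∃ M : Matrix (Fin ((a + 1) + (a + 1))) (Fin (a + (a + 2))) (ZMod 2),
      (∀ v, Ψ v = M *ᵥ v) ∧ M = LinearMap.toMatrix' Ψ.toLinearMap :=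
    ⟨_, fun v => (LinearMap.toMatrix'_mulVec Ψ.toLinearMap v).symm, rfl⟩
  obtain ⟨M', hM'M, hMM'⟩ : ∃ M' : Matrix (Fin (a + (a + 2))) (Fin ((a + 1) + (a + 1))) (ZMod 2),
      M' * M = 1 ∧ M * M' = 1 := by
    refine ⟨LinearMap.toMatrix' Ψ.symm.toLinearMap, ?_, ?_⟩
    · rw [hMdef, ← LinearMap.toMatrix'_comp, LinearEquiv.symm_comp]
      exact LinearMap.toMatrix'_id
    · rw [hMdef, ← LinearMap.toMatrix'_comp, LinearEquiv.comp_symm]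
      exact LinearMap.toMatrix'_id
  -- the new pair: `g₁ = g ∘ M`, `f₁ = f ∘ M'ᵀ`
  obtain ⟨g₁, hg₁⟩ : ∃ g₁ : (Fin (a + (a + 2)) → Bool) → Bool, ∀ y, g₁ y = g (ιn.symm (M *ᵥ ind y)) :=
    ⟨_, fun _ => rfl⟩
  obtain ⟨f₁, hf₁⟩ : ∃ f₁ : (Fin (a + (a + 2)) → Bool) → Bool, ∀ x, f₁ x = f (ιn.symm (M'ᵀ *ᵥ ind x)) :=
    ⟨_, fun _ => rfl⟩
  have hg₁deg : IsDegLeFun 3 g₁ := by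
    rw [show g₁ = fun y => g (ιn.symm (M *ᵥ ind y)) from funext hg₁]
    exact nf_isDegLeFun_mulVec M ιn.symm hι' hg
  have hg₁G : ∀ (y₁ : Fin a → Bool) (y₂ : Fin (a + 2) → Bool),
      g₁ (Fin.append y₁ y₂) = G (Ψ (Fin.append (ind y₁) (ind y₂))) := by
    intro y₁ y₂
    rw [hg₁, hGι, ← hΨM, dnf_ind_append]
  -- the coordinate change `e : y ↦ ind⁻¹ (M · ind y)` as a bijection, with `g ∘ e = g₁`, additive
  obtain ⟨e, he⟩ : ∃ e : (Fin (a + (a + 2)) → Bool) ≃ (Fin ((a + 1) + (a + 1)) → Bool),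
      ∀ y, e y = ιn.symm (M *ᵥ ind y) :=
    ⟨ιk.trans (Ψ.toEquiv.trans ιn.symm), fun y => by
      show ιn.symm (Ψ (ιk y)) = _
      rw [hιk, hΨM]⟩
  have hge : ∀ y, g (e y) = g₁ y := fun y => by rw [he, hg₁]
  have he0 : e zeroVec = zeroVec := by
    apply ind_injective
    rw [he, hι']
    have h0 : ind (zeroVec : Fin (a + (a + 2)) → Bool) = 0 := by
      funext i; simp [ind, BuzetChailloux.zeroVec]
    have h0' : ind (zeroVec : Fin ((a + 1) + (a + 1)) → Bool) = 0 := by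
      funext i; simp [ind, BuzetChailloux.zeroVec]
    rw [h0, h0', Matrix.mulVec_zero]
  have headd : ∀ x y, e (bxor x y) = bxor (e x) (e y) := fun x y => by
    apply ind_injective
    rw [hbx, he, he, he, hι', hι', hι', hbx, Matrix.mulVec_add]
  -- the Maiorana–McFarland data: `P y″ i = G(w ⊕ v_i) ⊕ G(w)`, `w = w(y″)`, and the shape `hMM`
  obtain ⟨P, hP⟩ : ∃ P : (Fin (a + 2) → Bool) → (Fin a → Bool),
      ∀ y'' i, P y'' i = (G (w (ind y'') + bV i) ^^ G (w (ind y''))) := ⟨_, fun _ _ => rfl⟩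
  have hpt : ∀ (y' : Fin a → Bool) (y'' : Fin (a + 2) → Bool), Ψ (Fin.append (ind y') (ind y'')) =
      w (ind y'') + ∑ i ∈ Finset.univ.filter (fun i => y' i = true), bV i := by
    intro y' y''
    rw [hΨ, Finset.sum_filter]
    congr 1
    refine Finset.sum_congr rfl fun i _ => ?_
    simp only [ind, ite_zero_smul, one_smul]
  have hMM : ∀ (y' : Fin a → Bool) (y'' : Fin (a + 2) → Bool),
      (if G (Ψ (Fin.append (ind y') (ind y''))) then (1 : ZMod 2) else 0) =
        (∑ i, (if y' i then (1 : ZMod 2) else 0) * (if P y'' i then (1 : ZMod 2) else 0)) +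
          (if G (w (ind y'')) then (1 : ZMod 2) else 0) := by
    intro y' y''
    have key := dnf_affine S (fun v => if G v then (1 : ZMod 2) else 0) hD' (w (ind y'')) bV hbV
      (Finset.univ.filter fun i => y' i = true)
    beta_reduce at key
    rw [hpt, key, add_comm (if G (w (ind y'')) then (1 : ZMod 2) else 0), Finset.sum_filter]
    congr 1
    refine Finset.sum_congr rfl fun i _ => ?_
    rw [boole_mul, hP, ite_xor]
  -- values of `g₁` on the flat `{y₁ = 0}` and on its translates by the unit vectors `e_i ‖ 0`
  have hflat0 : ∀ y₂ : Fin (a + 2) → Bool, g₁ (Fin.append zeroVec y₂) = G (w (ind y₂)) := by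
    intro y₂
    have h0 : (∑ i, ind (zeroVec : Fin a → Bool) i • bV i) = 0 := by
      simp [ind, BuzetChailloux.zeroVec]
    rw [hg₁G, hΨ, h0, add_zero]
  have hflat1 : ∀ (y₂ : Fin (a + 2) → Bool) (i : Fin a),
      g₁ (Fin.append (fun j => decide (j = i)) y₂) = G (w (ind y₂) + bV i) := by
    intro y₂ i
    have h1 : (∑ j, ind (fun j : Fin a => decide (j = i)) j • bV j) = bV i := by
      simp [ind, ite_smul, Finset.sum_ite_eq']
    rw [hg₁G, hΨ, h1]
  -- `φ` and `h` in the new coordinates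
  obtain ⟨φ, hφ⟩ : ∃ φ : (Fin (a + 2) → Bool) → (Fin a → Bool), ∀ y₂ i,
      φ y₂ i = (g₁ (Fin.append zeroVec y₂) ^^ g₁ (Fin.append (fun j => decide (j = i)) y₂)) :=
    ⟨_, fun _ _ => rfl⟩
  obtain ⟨h, hh⟩ : ∃ h : (Fin (a + 2) → Bool) → Bool, ∀ y₂, h y₂ = g₁ (Fin.append zeroVec y₂) :=
    ⟨_, fun _ => rfl⟩
  have hφP : ∀ y₂, φ y₂ = P y₂ := fun y₂ => funext fun i => by
    rw [hφ, hP, hflat0, hflat1, Bool.xor_comm]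
  refine ⟨f₁, g₁, φ, h, ?_, fun i => ?_, ?_, fun y₁ y₂ => ?_, ?_, ?_⟩
  · -- `f₁` is cubic: a linear substitution in the cubic `f`
    rw [show f₁ = fun x => f (ιn.symm (M'ᵀ *ᵥ ind x)) from funext hf₁]
    exact nf_isDegLeFun_mulVec M'ᵀ ιn.symm hι' hf
  · -- `φ · i` is quadratic: the derivative of the cubic `g₁` in direction `e_i ‖ 0`, restricted to `{y₁ = 0}`
    have key := nf_isDegLeFun_restrict (m := a)
      (hD (a + (a + 2)) 2 g₁ (Fin.append (fun j => decide (j = i)) zeroVec) hg₁deg)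
    rw [show (fun y => φ y i) = fun y => (g₁ (Fin.append zeroVec y) ^^
        g₁ (bxor (Fin.append zeroVec y) (Fin.append (fun j => decide (j = i)) zeroVec))) from
      funext fun y => by
        rw [hφ, nf_bxor_append, BuzetChailloux.zeroVec_bxor, BuzetChailloux.bxor_zeroVec]]
    exact key
  · -- `h` is cubic: the restriction of the cubic `g₁` to `{y₁ = 0}`
    rw [show h = fun y₂ => g₁ (Fin.append zeroVec y₂) from funext hh]
    exact nf_isDegLeFun_restrict hg₁deg
  · -- the sign shape, from `hMM`
    rw [hh, hflat0, hφP, hg₁G, dnf_signOf_eq_chi (G (Ψ (Fin.append (ind y₁) (ind y₂)))), hMM, dnf_chi_add,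
      dnf_signOf_eq_chi (G (w (ind y₂))), dnf_twist_eq_chi]
    rfl
  · -- the forrelation is unchanged: `⟨x, M y⟩ = ⟨Mᵀ x, y⟩` and two reindexings (over equinumerous types)
    unfold forrelation
    congr 1
    · rw [hKN]
    have hεε : ∀ x, ιk.symm (Mᵀ *ᵥ ind (ιn.symm (M'ᵀ *ᵥ ind x))) = x := fun x => by
      rw [hι', Matrix.mulVec_mulVec, ← Matrix.transpose_mul, hM'M, Matrix.transpose_one, Matrix.one_mulVec,
        hιks]
    have hεε' : ∀ x, ιn.symm (M'ᵀ *ᵥ ind (ιk.symm (Mᵀ *ᵥ ind x))) = x := fun x => by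
      rw [hιk', Matrix.mulVec_mulVec, ← Matrix.transpose_mul, hMM', Matrix.transpose_one, Matrix.one_mulVec,
        hιs]
    obtain ⟨ε, hε⟩ : ∃ ε : (Fin (a + (a + 2)) → Bool) ≃ (Fin ((a + 1) + (a + 1)) → Bool),
        ∀ x, ε x = ιn.symm (M'ᵀ *ᵥ ind x) :=
      ⟨⟨fun x => ιn.symm (M'ᵀ *ᵥ ind x), fun x => ιk.symm (Mᵀ *ᵥ ind x), hεε, hεε'⟩, fun _ => rfl⟩
    have htwist : ∀ x y, twist x (e y) = twist (ιk.symm (Mᵀ *ᵥ ind x)) y := fun x y => by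
      rw [dnf_twist_eq_chi, dnf_twist_eq_chi, he, hι', hιk', Matrix.dotProduct_mulVec, ← Matrix.mulVec_transpose]
    symm
    calc ∑ x, ∑ y, signOf (f x) * twist x y * signOf (g y)
        = ∑ x, ∑ y, signOf (f x) * twist x (e y) * signOf (g (e y)) :=
          Finset.sum_congr rfl fun x _ =>
            (Equiv.sum_comp e (fun y => signOf (f x) * twist x y * signOf (g y))).symm
      _ = ∑ y, ∑ x, signOf (f x) * twist (ιk.symm (Mᵀ *ᵥ ind x)) y * signOf (g₁ y) := by
          rw [Finset.sum_comm]
          refine Finset.sum_congr rfl fun y _ => Finset.sum_congr rfl fun x _ => ?_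
          rw [htwist, hge]
      _ = ∑ y, ∑ x, signOf (f₁ x) * twist x y * signOf (g₁ y) := by
          refine Finset.sum_congr rfl fun y _ => ?_
          rw [← ε.bijective.sum_comp (fun x => signOf (f x) * twist (ιk.symm (Mᵀ *ᵥ ind x)) y * signOf (g₁ y))]
          refine Finset.sum_congr rfl fun x _ => ?_
          simp only [hε, hεε, hf₁]
      _ = ∑ x, ∑ y, signOf (f₁ x) * twist x y * signOf (g₁ y) := Finset.sum_comm
  · -- an M-subspace `V₁` of `g₁` is carried by the additive bijection `e` (`g ∘ e = g₁`) to one of `g`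
    rintro ⟨V₁, hV₁0, hV₁x, hV₁c, hV₁D⟩
    refine ⟨V₁.image e, Finset.mem_image.2 ⟨zeroVec, hV₁0, he0⟩, fun x hx y hy => ?_, ?_, fun u hu v hv y => ?_⟩
    · obtain ⟨x', hx', rfl⟩ := Finset.mem_image.1 hx
      obtain ⟨y', hy', rfl⟩ := Finset.mem_image.1 hy
      exact Finset.mem_image.2 ⟨bxor x' y', hV₁x x' hx' y' hy', headd x' y'⟩
    · rw [Finset.card_image_of_injective _ e.injective, hV₁c, hKN]
    · obtain ⟨u', hu', rfl⟩ := Finset.mem_image.1 hu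
      obtain ⟨v', hv', rfl⟩ := Finset.mem_image.1 hv
      obtain ⟨y', rfl⟩ := e.surjective y
      have key := hV₁D u' hu' v' hv' y'
      rw [← hge, ← hge, ← hge, ← hge, headd, headd, headd, headd] at key
      exact key

end Summit.QuantumAdvantage.QuantumAdvantage.Theorems.CubicForrelation.NearExactIsExact
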